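import Summits.ValiantsHypothesis.ValiantsHypothesis.Theorems.BarrierLeverPartitionMinorsChowDoubleStepPrelims
import Summits.ValiantsHypothesis.ValiantsHypothesis.Theorems.BarrierLeverPartitionMinorsChowDoubleStepDet

/-!
# Route BarrierLever — Chow witnesses for partition minors (item 20172, CPM): the DOUBLE STEP
# (`k = 2` tensor blow-down: two star-like row coordinates against a double collision of the columns)

Helper file (`--supports stmt-ValiantsHypothesis-20172`; cell valiant-natproofs, rung V4, 𝒟-side of
door (c); seat val-np-p4 gen 13).  Closes NO item.  Conventions of items 19717 / 20172 / 20195: a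
layout `(u, w)` of height `h` is HIT when some product of `h + h` affine forms has nonsingular
partition minor `det[coeff_{E (u i) (w j)} ∏ ℓ]`.

**The double step (`chow_doubleStep`).**  Height `h + 2`, size `r + 2`; two row coordinates `a`,
`a' = a.succAbove a''` and two column coordinates `c`, `c' = c.succAbove c''`.  ROWS star-like with
respect to `{a, a'}`: a base row `i₀` and two special rows `v₁`, `v₂ = v₁.succAbove v₂''` having the
`{a,a'}`-erased label of `i₀`, with `v₁` differing from `i₀` exactly in the `a`-status and `v₂` exactly
in the `a'`-status (for a STAR with centre `B` and ANY two coordinates: `i₀ = B`, `v₁ = B ∆ a`,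
`v₂ = B ∆ a'`; the other rows automatically share the statuses of `B`).  COLUMNS: two excess columns
`j₁`, `j₂ = j₁.succAbove j₂''` whose `{c,c'}`-erased labels equal those of `j₀` resp. `j₀'` (a DOUBLE
COLLISION: two collision pairs, or one triple if `j₀ = j₀'`), with NONSINGULAR status-difference
matrix `δ_{pe} = [c_p ∈ w j_e] − [c_p ∈ w j_{rep(e)}]` — e.g. a NESTED pair `w j₁ = w j₀ ∪ {c, c'}`
together with a CROSSING pair `w j₂ = (w j₀' \ c') ∪ c` (`δ = [[1,1],[1,−1]]`), the configuration
that EDGELESS column families offer.  If the reduced layout of height `h` and size `r` (drop rows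
`v₁, v₂` and columns `j₁, j₂`; delete `a, a'` and `c, c'`; pull back twice) is hit, then `(u, w)` is
hit.  (Injectivity of the reduced layout — exactly two collisions — is the engine's bookkeeping.)

Proof = the edge step twice, simultaneously: common witness `F` (height `h`) for the reduced layout
and the two `1 × 1` entries (`exists_common_chow_witness₃`), lifted twice; gadget = the product of
the two edge gadgets `g_t(x_a, y_c) · g_t(x_{a'}, y_{c'})` (four affine forms); the partition matrix
is `t^{[a∈u i][c∈w j]} · t^{[a'∈u i][c'∈w j]} · F̃ i j` (`coeff_partitionExpo_mul_pairFactor` twice);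
`exists_det_doubleEdge_ne_zero` (`…ChowDoubleStepDet`: `(X − 1)²` factor, block Laplace) gives `t`.
Identity verified exactly beforehand (seat scripts kit/tensorgadget_check.py, kit/tensor_k_check.py;
memo HOME/val-np-p4/g13 §2).  Census: at `(h, r) = (5, 6)` the double step applies to `114 240` of
the `351 840` star-row cores surviving the leaf/edge engine (kit j282264).

WHAT THIS IS NOT: a reduction step; star rows against columns all of whose double collisions are
of the same kind (e.g. `{∅,01,02,13,23}` at height `4`) are untouched; nothing on items 20172 /
20195 / 19717 themselves, on crux stmt-ValiantsHypothesis-14610, or on `VP` versus `VNP`.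
-/

set_option linter.dupNamespace false

namespace Summit.ValiantsHypothesis.ValiantsHypothesis.Theorems.BarrierLever.ChowFactor

open Finset MvPolynomial
open Summit.ValiantsHypothesis.ValiantsHypothesis.Theorems.BarrierLever.ProductStateSums (castAdd_ne_natAdd)

noncomputable section

variable {h : ℕ}

/-! ## 3. The double step -/

/-- **THE DOUBLE STEP for Chow witnesses** (`k = 2` tensor blow-down).  See the module docstring for
the hypotheses; the conclusion is that `(u, w)` is hit at height `h + 2` as soon as the doubly
reduced layout is hit at height `h`. -/
theorem chow_doubleStep (a c : Fin (h + 2)) (a'' c'' : Fin (h + 1)) {r : ℕ}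
    (u w : Fin (r + 2) → Finset (Fin (h + 2))) (i₀ v₁ : Fin (r + 2)) (v₂'' : Fin (r + 1))
    (j₀ j₀' j₁ : Fin (r + 2)) (j₂'' : Fin (r + 1))
    (hi₁ : v₁ ≠ i₀) (hi₂ : v₁.succAbove v₂'' ≠ i₀)
    (ha₁ : a ∈ u v₁ ↔ a ∉ u i₀) (ha'₁ : a.succAbove a'' ∈ u v₁ ↔ a.succAbove a'' ∈ u i₀)
    (ha₂ : a ∈ u (v₁.succAbove v₂'') ↔ a ∈ u i₀)
    (ha'₂ : a.succAbove a'' ∈ u (v₁.succAbove v₂'') ↔ a.succAbove a'' ∉ u i₀)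
    (hlab₁ : ((u v₁).erase a).erase (a.succAbove a'') = ((u i₀).erase a).erase (a.succAbove a''))
    (hlab₂ : ((u (v₁.succAbove v₂'')).erase a).erase (a.succAbove a'') =
      ((u i₀).erase a).erase (a.succAbove a''))
    (hj₀ : j₀ ≠ j₁) (hj₀' : j₀' ≠ j₁) (hj₀'₂ : j₀' ≠ j₁.succAbove j₂'')
    (hcol₁ : ((w j₁).erase c).erase (c.succAbove c'') = ((w j₀).erase c).erase (c.succAbove c''))
    (hcol₂ : ((w (j₁.succAbove j₂'')).erase c).erase (c.succAbove c'') =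
      ((w j₀').erase c).erase (c.succAbove c''))
    (hδ : ((if c ∈ w j₁ then (1 : ℂ) else 0) - (if c ∈ w j₀ then 1 else 0)) *
        ((if c.succAbove c'' ∈ w (j₁.succAbove j₂'') then (1 : ℂ) else 0) -
          (if c.succAbove c'' ∈ w j₀' then 1 else 0)) ≠
      ((if c ∈ w (j₁.succAbove j₂'') then (1 : ℂ) else 0) - (if c ∈ w j₀' then 1 else 0)) *
        ((if c.succAbove c'' ∈ w j₁ then (1 : ℂ) else 0) - (if c.succAbove c'' ∈ w j₀ then 1 else 0)))
    (hred : ∃ ℓ : Fin (h + h) → MvPolynomial (Fin (h + h)) ℂ, (∀ q, (ℓ q).totalDegree ≤ 1) ∧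
      (Matrix.of fun k l : Fin r => coeff
        (∑ b ∈ ((u (v₁.succAbove (v₂''.succAbove k))).preimage a.succAbove
              Fin.succAbove_right_injective.injOn).preimage a''.succAbove
              Fin.succAbove_right_injective.injOn,
            Finsupp.single (Fin.castAdd h b) 1 +
          ∑ d ∈ ((w (j₁.succAbove (j₂''.succAbove l))).preimage c.succAbove
              Fin.succAbove_right_injective.injOn).preimage c''.succAbove
              Fin.succAbove_right_injective.injOn,
            Finsupp.single (Fin.natAdd h d) 1)
        (∏ q, ℓ q)).det ≠ 0) :
    ∃ ℓ : Fin ((h + 2) + (h + 2)) → MvPolynomial (Fin ((h + 2) + (h + 2))) ℂ,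
      (∀ q, (ℓ q).totalDegree ≤ 1) ∧
      (Matrix.of fun i j : Fin (r + 2) => coeff
        (∑ x ∈ u i, Finsupp.single (Fin.castAdd (h + 2) x) 1 +
          ∑ y ∈ w j, Finsupp.single (Fin.natAdd (h + 2) y) 1)
        (∏ q, ℓ q)).det ≠ 0 := by
  classical
  set a' := a.succAbove a'' with ha'
  set c' := c.succAbove c'' with hc'
  set v₂ := v₁.succAbove v₂'' with hv₂
  set j₂ := j₁.succAbove j₂'' with hj₂
  have haa' : a' ≠ a := Fin.succAbove_ne a a''
  have hcc' : c' ≠ c := Fin.succAbove_ne c c''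
  -- the double pull-back
  set pre₂x : Finset (Fin (h + 2)) → Finset (Fin h) := fun S =>
    (S.preimage a.succAbove Fin.succAbove_right_injective.injOn).preimage a''.succAbove
      Fin.succAbove_right_injective.injOn with hpre₂x
  set pre₂y : Finset (Fin (h + 2)) → Finset (Fin h) := fun T =>
    (T.preimage c.succAbove Fin.succAbove_right_injective.injOn).preimage c''.succAbove
      Fin.succAbove_right_injective.injOn with hpre₂y
  -- the two `1 × 1` layouts are hit
  have hone : ∀ S T : Finset (Fin h), ∃ ℓ : Fin (h + h) → MvPolynomial (Fin (h + h)) ℂ,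
      (∀ q, (ℓ q).totalDegree ≤ 1) ∧
      (Matrix.of fun _ _ : Fin 1 => coeff
        (∑ b ∈ S, Finsupp.single (Fin.castAdd h b) 1 + ∑ d ∈ T, Finsupp.single (Fin.natAdd h d) 1)
        (∏ q, ℓ q)).det ≠ 0 := fun S T =>
    chowHits_of_size_le_three h 1 (by norm_num) (fun _ => S) (fun _ => T)
      (Function.injective_of_subsingleton _) (Function.injective_of_subsingleton _)
  obtain ⟨ℓ, hdeg, hA, hD₁, hD₂⟩ := exists_common_chow_witness₃ _ _ _ _ _ _ hred
    (hone (pre₂x (u i₀)) (pre₂y (w j₀))) (hone (pre₂x (u i₀)) (pre₂y (w j₀')))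
  rw [Matrix.det_fin_one, Matrix.of_apply] at hD₁ hD₂
  -- the coefficient matrix of the (future) doubly lifted witness
  set F : Matrix (Fin (r + 2)) (Fin (r + 2)) ℂ := Matrix.of fun i j => coeff
      (∑ b ∈ pre₂x (u i), Finsupp.single (Fin.castAdd h b) 1 +
        ∑ d ∈ pre₂y (w j), Finsupp.single (Fin.natAdd h d) 1) (∏ q, ℓ q) with hFdef
  have hrow₁ : ∀ j, F v₁ j = F i₀ j := fun j => by
    rw [hFdef, Matrix.of_apply, Matrix.of_apply, hpre₂x]
    simp only []
    rw [preimage₂_eq_of_erase₂_eq a a'' hlab₁]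
  have hrow₂ : ∀ j, F v₂ j = F i₀ j := fun j => by
    rw [hFdef, Matrix.of_apply, Matrix.of_apply, hpre₂x]
    simp only []
    rw [preimage₂_eq_of_erase₂_eq a a'' hlab₂]
  have hFc₁ : ∀ i, F i j₁ = F i j₀ := fun i => by
    rw [hFdef, Matrix.of_apply, Matrix.of_apply, hpre₂y]
    simp only []
    rw [preimage₂_eq_of_erase₂_eq c c'' hcol₁]
  have hFc₂ : ∀ i, F i j₂ = F i j₀' := fun i => by
    rw [hFdef, Matrix.of_apply, Matrix.of_apply, hpre₂y]
    simp only []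
    rw [preimage₂_eq_of_erase₂_eq c c'' hcol₂]
  have hminor : (F.submatrix (fun k => v₁.succAbove (v₂''.succAbove k))
      (fun k => j₁.succAbove (j₂''.succAbove k))).det ≠ 0 := by
    have hsub : F.submatrix (fun k => v₁.succAbove (v₂''.succAbove k))
        (fun k => j₁.succAbove (j₂''.succAbove k)) = Matrix.of fun k l : Fin r => coeff
        (∑ b ∈ pre₂x (u (v₁.succAbove (v₂''.succAbove k))), Finsupp.single (Fin.castAdd h b) 1 +
          ∑ d ∈ pre₂y (w (j₁.succAbove (j₂''.succAbove l))), Finsupp.single (Fin.natAdd h d) 1)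
        (∏ q, ℓ q) := by
      ext k l; rw [Matrix.submatrix_apply, hFdef, Matrix.of_apply, Matrix.of_apply]
    rw [hsub]
    exact hA
  have hent₁ : F i₀ j₀ ≠ 0 := by rw [hFdef, Matrix.of_apply]; exact hD₁
  have hent₂ : F i₀ j₀' ≠ 0 := by rw [hFdef, Matrix.of_apply]; exact hD₂
  -- the parameter
  obtain ⟨t, ht⟩ := exists_det_doubleEdge_ne_zero F (fun i => a ∈ u i) (fun i => a' ∈ u i)
    (fun j => c ∈ w j) (fun j => c' ∈ w j) i₀ v₁ v₂'' j₀ j₀' j₁ j₂'' hi₁ hi₂ ha₁ ha'₁ ha₂ ha'₂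
    hrow₁ hrow₂ hj₀ hj₀' hj₀'₂ hFc₁ hFc₂ hδ hent₁ hent₂ hminor
  -- the two lifts and the four gadget forms
  set L₁ : Fin (h + h) → Fin ((h + 1) + (h + 1)) := Fin.append
    (fun b : Fin h => Fin.castAdd (h + 1) (a''.succAbove b))
    (fun d : Fin h => Fin.natAdd (h + 1) (c''.succAbove d)) with hL₁
  set L₂ : Fin ((h + 1) + (h + 1)) → Fin ((h + 2) + (h + 2)) := Fin.append
    (fun b : Fin (h + 1) => Fin.castAdd (h + 2) (a.succAbove b))
    (fun d : Fin (h + 1) => Fin.natAdd (h + 2) (c.succAbove d)) with hL₂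
  set g₁ : MvPolynomial (Fin ((h + 2) + (h + 2))) ℂ :=
    C 1 + C 1 * X (Fin.castAdd (h + 2) a) + C (1 - t) * X (Fin.natAdd (h + 2) c) with hg₁
  set g₂ : MvPolynomial (Fin ((h + 2) + (h + 2))) ℂ :=
    C 1 + C 0 * X (Fin.castAdd (h + 2) a) + C t * X (Fin.natAdd (h + 2) c) with hg₂
  set g₃ : MvPolynomial (Fin ((h + 2) + (h + 2))) ℂ :=
    C 1 + C 1 * X (Fin.castAdd (h + 2) a') + C (1 - t) * X (Fin.natAdd (h + 2) c') with hg₃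
  set g₄ : MvPolynomial (Fin ((h + 2) + (h + 2))) ℂ :=
    C 1 + C 0 * X (Fin.castAdd (h + 2) a') + C t * X (Fin.natAdd (h + 2) c') with hg₄
  set F₂ : MvPolynomial (Fin ((h + 2) + (h + 2))) ℂ := rename L₂ (rename L₁ (∏ q, ℓ q)) with hF₂
  have hcard : (h + h) + 4 = (h + 2) + (h + 2) := by omega
  set e : Fin ((h + h) + 4) ≃ Fin ((h + 2) + (h + 2)) := finCongr hcard with he
  set ℓ' : Fin ((h + h) + 4) → MvPolynomial (Fin ((h + 2) + (h + 2))) ℂ :=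
    Fin.append (fun q => rename L₂ (rename L₁ (ℓ q))) ![g₁, g₂, g₃, g₄] with hℓ'
  refine ⟨fun q => ℓ' (e.symm q), fun q => ?_, ?_⟩
  · show (ℓ' (e.symm q)).totalDegree ≤ 1
    generalize e.symm q = q₀
    rw [hℓ']
    induction q₀ using Fin.addCases with
    | left q' =>
      rw [Fin.append_left]
      exact totalDegree_rename_le_one L₂ _ (totalDegree_rename_le_one L₁ (ℓ q') (hdeg q'))
    | right q' =>
      rw [Fin.append_right]
      fin_cases q'
      · exact totalDegree_affine_xy_le a c 1 (1 - t)
      · exact totalDegree_affine_xy_le a c 0 t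
      · exact totalDegree_affine_xy_le a' c' 1 (1 - t)
      · exact totalDegree_affine_xy_le a' c' 0 t
  · -- the product
    have hprod : (∏ q, ℓ' (e.symm q)) = (g₁ * g₂) * ((g₃ * g₄) * F₂) := by
      rw [Fintype.prod_equiv e.symm (fun q => ℓ' (e.symm q)) ℓ' (fun _ => rfl), hℓ',
        Fin.prod_univ_add]
      simp only [Fin.append_left, Fin.append_right, Fin.prod_univ_four, Matrix.cons_val_zero,
        Matrix.cons_val_one, Matrix.cons_val]
      rw [hF₂, map_prod, map_prod]
      ring
    rw [hprod]
    -- support facts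
    have hg₃₄ : ∀ m ∈ (g₃ * g₄).support, ∀ v,
        ¬ (v = Fin.castAdd (h + 2) a' ∨ v = Fin.natAdd (h + 2) c') → m v = 0 :=
      support_edgeGadget a' c' t
    have hg₃₄' : ∀ m ∈ (g₃ * g₄).support, ∀ v,
        (v = Fin.castAdd (h + 2) a ∨ v = Fin.natAdd (h + 2) c) → m v = 0 := by
      intro m hm v hv
      refine hg₃₄ m hm v ?_
      rcases hv with rfl | rfl
      · rintro (h1 | h2)
        · exact haa' (Fin.castAdd_injective _ _ h1).symm
        · exact castAdd_ne_natAdd _ _ h2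
      · rintro (h1 | h2)
        · exact castAdd_ne_natAdd _ _ h1.symm
        · exact hcc' (Fin.natAdd_injective _ _ h2).symm
    have hF₂ac : ∀ m ∈ F₂.support, ∀ v,
        (v = Fin.castAdd (h + 2) a ∨ v = Fin.natAdd (h + 2) c) → m v = 0 :=
      support_rename_lift a c _
    have hF₂a'c' : ∀ m ∈ F₂.support, ∀ v,
        (v = Fin.castAdd (h + 2) a' ∨ v = Fin.natAdd (h + 2) c') → m v = 0 := by
      intro m hm v hv
      rcases hv with rfl | rfl
      · exact support_rename_lift_castAdd a c a'' _
          (fun m' hm' => support_rename_lift a'' c'' _ m' hm' _ (Or.inl rfl)) m hm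
      · exact support_rename_lift_natAdd a c c'' _
          (fun m' hm' => support_rename_lift a'' c'' _ m' hm' _ (Or.inr rfl)) m hm
    have hrest : ∀ m ∈ ((g₃ * g₄) * F₂).support, ∀ v,
        (v = Fin.castAdd (h + 2) a ∨ v = Fin.natAdd (h + 2) c) → m v = 0 :=
      support_mul_vanish _ _ _ hg₃₄' hF₂ac
    -- entries of the partition matrix
    have hentry : ∀ i j : Fin (r + 2), coeff
        (∑ x ∈ u i, Finsupp.single (Fin.castAdd (h + 2) x) 1 +
          ∑ y ∈ w j, Finsupp.single (Fin.natAdd (h + 2) y) 1) ((g₁ * g₂) * ((g₃ * g₄) * F₂)) =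
        (if a ∈ u i ∧ c ∈ w j then t else 1) * ((if a' ∈ u i ∧ c' ∈ w j then t else 1) * F i j) := by
      intro i j
      have hane : ({a} : Finset (Fin (h + 2))) ≠ ∅ := Finset.singleton_ne_empty a
      have hcne : ({c} : Finset (Fin (h + 2))) ≠ ∅ := Finset.singleton_ne_empty c
      have hane' : ({a'} : Finset (Fin (h + 2))) ≠ ∅ := Finset.singleton_ne_empty a'
      have hcne' : ({c'} : Finset (Fin (h + 2))) ≠ ∅ := Finset.singleton_ne_empty c'
      -- first pair `(a, c)`
      rw [coeff_partitionExpo_mul_pairFactor _ _ a c (support_edgeGadget a c t) hrest (u i) (w j)]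
      have hfa : (u i).filter (fun x => x = a) = u i ∩ {a} := by
        ext x; simp [Finset.mem_filter, Finset.mem_inter]
      have hfc : (w j).filter (fun y => y = c) = w j ∩ {c} := by
        ext x; simp [Finset.mem_filter, Finset.mem_inter]
      rw [hfa, hfc, coeff_edgeGadget a c t _ _ ?_ ?_]
      rotate_left
      · by_cases hx : a ∈ u i
        · right; rw [Finset.inter_singleton_of_mem hx]
        · left; rw [Finset.inter_singleton_of_notMem hx]
      · by_cases hy : c ∈ w j
        · right; rw [Finset.inter_singleton_of_mem hy]
        · left; rw [Finset.inter_singleton_of_notMem hy]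
      -- second pair `(a', c')`
      rw [coeff_partitionExpo_mul_pairFactor _ _ a' c' (support_edgeGadget a' c' t) hF₂a'c'
        ((u i).erase a) ((w j).erase c)]
      have hfa' : ((u i).erase a).filter (fun x => x = a') = u i ∩ {a'} := by
        ext x; simp only [Finset.mem_filter, Finset.mem_erase, Finset.mem_inter, Finset.mem_singleton]
        constructor
        · rintro ⟨⟨-, hx⟩, rfl⟩; exact ⟨hx, rfl⟩
        · rintro ⟨hx, rfl⟩; exact ⟨⟨haa', hx⟩, rfl⟩
      have hfc' : ((w j).erase c).filter (fun y => y = c') = w j ∩ {c'} := by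
        ext x; simp only [Finset.mem_filter, Finset.mem_erase, Finset.mem_inter, Finset.mem_singleton]
        constructor
        · rintro ⟨⟨-, hx⟩, rfl⟩; exact ⟨hx, rfl⟩
        · rintro ⟨hx, rfl⟩; exact ⟨⟨hcc', hx⟩, rfl⟩
      rw [hfa', hfc', coeff_edgeGadget a' c' t _ _ ?_ ?_]
      rotate_left
      · by_cases hx : a' ∈ u i
        · right; rw [Finset.inter_singleton_of_mem hx]
        · left; rw [Finset.inter_singleton_of_notMem hx]
      · by_cases hy : c' ∈ w j
        · right; rw [Finset.inter_singleton_of_mem hy]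
        · left; rw [Finset.inter_singleton_of_notMem hy]
      -- the doubly lifted coefficient
      have hSa : a ∉ ((u i).erase a).erase a' := fun hx =>
        (Finset.notMem_erase a (u i)) (Finset.mem_of_mem_erase hx)
      have hTc : c ∉ ((w j).erase c).erase c' := fun hx =>
        (Finset.notMem_erase c (w j)) (Finset.mem_of_mem_erase hx)
      have hlift₂ : coeff (∑ x ∈ ((u i).erase a).erase a', Finsupp.single (Fin.castAdd (h + 2) x) 1 +
          ∑ y ∈ ((w j).erase c).erase c', Finsupp.single (Fin.natAdd (h + 2) y) 1) F₂ = F i j := by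
        rw [hF₂, eq_map_preimage_succAbove_of_not_mem a _ hSa, eq_map_preimage_succAbove_of_not_mem c _ hTc,
          coeff_lift_rename]
        have hSa'' : a'' ∉ (((u i).erase a).erase a').preimage a.succAbove
            Fin.succAbove_right_injective.injOn := by
          rw [Finset.mem_preimage]; exact Finset.notMem_erase _ _
        have hTc'' : c'' ∉ (((w j).erase c).erase c').preimage c.succAbove
            Fin.succAbove_right_injective.injOn := by
          rw [Finset.mem_preimage]; exact Finset.notMem_erase _ _
        rw [eq_map_preimage_succAbove_of_not_mem a'' _ hSa'', eq_map_preimage_succAbove_of_not_mem c'' _ hTc'',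
          coeff_lift_rename, hFdef, Matrix.of_apply, hpre₂x, hpre₂y]
        simp only []
        rw [preimage₂_eq_of_erase₂_eq a a'' (S := ((u i).erase a).erase a') (T := u i)
            (erase₂_idem (u i) a a'),
          preimage₂_eq_of_erase₂_eq c c'' (S := ((w j).erase c).erase c') (T := w j)
            (erase₂_idem (w j) c c')]
      rw [hlift₂]
      -- the gadget coefficients
      have e1 : (if u i ∩ {a} = {a} ∧ w j ∩ {c} = {c} then t else 1) =
          (if a ∈ u i ∧ c ∈ w j then t else 1) := by
        by_cases hx : a ∈ u i <;> by_cases hy : c ∈ w j <;>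
          simp [Finset.inter_singleton_of_mem, Finset.inter_singleton_of_notMem, hx, hy, hane.symm, hcne.symm]
      have e2 : (if u i ∩ {a'} = {a'} ∧ w j ∩ {c'} = {c'} then t else 1) =
          (if a' ∈ u i ∧ c' ∈ w j then t else 1) := by
        by_cases hx : a' ∈ u i <;> by_cases hy : c' ∈ w j <;>
          simp [Finset.inter_singleton_of_mem, Finset.inter_singleton_of_notMem, hx, hy, hane'.symm,
            hcne'.symm]
      rw [e1, e2]
    have hM : (Matrix.of fun i j : Fin (r + 2) => coeff
        (∑ x ∈ u i, Finsupp.single (Fin.castAdd (h + 2) x) 1 +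
          ∑ y ∈ w j, Finsupp.single (Fin.natAdd (h + 2) y) 1) ((g₁ * g₂) * ((g₃ * g₄) * F₂))) =
        Matrix.of fun i j => (if a ∈ u i ∧ c ∈ w j then t else 1) *
          ((if a' ∈ u i ∧ c' ∈ w j then t else 1) * F i j) := by
      ext i j
      rw [Matrix.of_apply, hentry, Matrix.of_apply]
    rw [hM]
    exact ht

end

end Summit.ValiantsHypothesis.ValiantsHypothesis.Theorems.BarrierLever.ChowFactor
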